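import Mathlib
import HarnessLib
import Summits.AtomisticToContinuum.Crystallization.Theorems.FrustratedLawDichotomyAperiodicFrustratedLawGapErgodicCondKernel

/-!
# Ergodic reduction for the crux `AperiodicFrustratedLawGap` — conditional laws are carried by level sets

Route `FrustratedLawDichotomy`, crux `AperiodicFrustratedLawGap` (item `stmt-AtomisticToContinuum-27623`),
registered stub `stub_ergodicReduction` (skeleton `dd3251ad731e`); brick for steps S3/S4 of the `hErg` plan
(evidence `D5-PLAN.md`).  Generic facts about the conditional laws `κ = condExpKernel Q m` of a finite measure on
a standard Borel space given a sub-σ-algebra `m`: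

* `ae_condExpKernel_apply_eq_indicator` — for `A ∈ m`: `κ_ω(A) = 1_A(ω)` for `Q`-a.e. `ω`;
* `ae_condExpKernel_eq_zero_of_measure_eq_zero` — `Q(N) = 0 ⇒ κ_ω(N) = 0` for `Q`-a.e. `ω`;
* `eq_of_forall_rat_le_iff` — two reals with the same rational upper bounds are equal;
* `ae_condExpKernel_levelSet_eq_one` — **atoms**: for countably many `m`-measurable real functions `h i`,
  `Q`-a.e. `ω` has `κ_ω {ω' | ∀ i, h i ω' = h i ω} = 1` (the conditional law sits on the joint level set of
  `ω`; in step S4 the `h i` are the invariant Cesàro limits `f̄_j` and the evaluations `ω ↦ κ_ω(d_j)`).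

`[folklore]` (Kallenberg FMP3 Thm 8.5 / Lemma 10.25 bookkeeping).
-/

noncomputable section

namespace Summit.AtomisticToContinuum.Crystallization.Theorems.FrustratedLawDichotomyErgodicReduction

open MeasureTheory Set Filter ProbabilityTheory
open scoped ENNReal

section Generic

variable {Ω : Type*} {m : MeasurableSpace Ω} [mΩ : MeasurableSpace Ω] [StandardBorelSpace Ω]
  {Q : Measure Ω} [IsFiniteMeasure Q]

/-- **Conditional laws of `m`-events are indicators**: for `A ∈ m`, `condExpKernel Q m ω (A) = 1_A(ω)` for
`Q`-a.e. `ω` (both sides are `m`-measurable with the same integrals over `m`-events). [folklore] -/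
theorem ae_condExpKernel_apply_eq_indicator (hm : m ≤ mΩ) {A : Set Ω} (hA : MeasurableSet[m] A) :
    ∀ᵐ ω ∂Q, condExpKernel Q m ω A = A.indicator 1 ω := by
  have h1 : Measurable[m] fun ω => condExpKernel Q m ω A := measurable_condExpKernel (hm A hA)
  have h2 : Measurable[m] (A.indicator (1 : Ω → ℝ≥0∞)) :=
    (measurable_const : Measurable[m] fun _ : Ω => (1 : ℝ≥0∞)).indicator hA
  refine ae_eq_of_forall_setLIntegral_eq_of_measurable_sub hm h1 h2 fun A' hA' => ?_
  rw [setLIntegral_condExpKernel hm hA' (hm A hA), lintegral_indicator_one (hm A hA),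
    Measure.restrict_apply (hm A hA)]

/-- **Null sets stay null for almost every conditional law**: `Q(N) = 0` implies `condExpKernel Q m ω (N) = 0`
for `Q`-a.e. `ω`. [folklore] -/
theorem ae_condExpKernel_eq_zero_of_measure_eq_zero (hm : m ≤ mΩ) {N : Set Ω} (hN : MeasurableSet N)
    (hQN : Q N = 0) : ∀ᵐ ω ∂Q, condExpKernel Q m ω N = 0 := by
  have h := setLIntegral_condExpKernel (Q := Q) hm (@MeasurableSet.univ Ω m) hN
  rw [Measure.restrict_univ, inter_univ, hQN] at h
  have hmeas : Measurable fun ω => condExpKernel Q m ω N :=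
    (measurable_condExpKernel (m := m) hN).mono hm le_rfl
  exact (lintegral_eq_zero_iff hmeas).1 h

omit [StandardBorelSpace Ω] [IsFiniteMeasure Q] in
/-- Two real numbers with the same rational upper bounds are equal. [folklore] -/
theorem eq_of_forall_rat_le_iff {a b : ℝ} (h : ∀ q : ℚ, a ≤ q ↔ b ≤ q) : a = b := by
  by_contra hne
  rcases lt_or_gt_of_ne hne with hlt | hlt
  · obtain ⟨q, hq1, hq2⟩ := exists_rat_btwn hlt
    exact absurd ((h q).1 hq1.le) (not_le.2 hq2)
  · obtain ⟨q, hq1, hq2⟩ := exists_rat_btwn hlt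
    exact absurd ((h q).2 hq1.le) (not_le.2 hq2)

/-- **Conditional laws are carried by the joint level sets of countably many `m`-measurable functions.**  For
`m`-measurable real functions `h i` (`i : ℕ`): for `Q`-a.e. `ω`, `condExpKernel Q m ω {ω' | ∀ i, h i ω' = h i ω} = 1`.
(For each `i` and rational `q` the event `{h i ≤ q}` lies in `m`, so its conditional probability is its indicator;
countably many such events pin down every `h i ω'` to `h i ω`.) [folklore] -/
theorem ae_condExpKernel_levelSet_eq_one (hm : m ≤ mΩ) {h : ℕ → Ω → ℝ} (hh : ∀ i, Measurable[m] (h i)) :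
    ∀ᵐ ω ∂Q, condExpKernel Q m ω {ω' | ∀ i, h i ω' = h i ω} = 1 := by
  -- the countable family of `m`-events `{h i ≤ q}`
  have hA : ∀ (i : ℕ) (q : ℚ), MeasurableSet[m] {ω' | h i ω' ≤ q} := fun i q =>
    (hh i) measurableSet_Iic
  have hae : ∀ᵐ ω ∂Q, ∀ (i : ℕ) (q : ℚ),
      condExpKernel Q m ω {ω' | h i ω' ≤ q} = ({ω' | h i ω' ≤ q} : Set Ω).indicator 1 ω := by
    rw [ae_all_iff]; intro i
    rw [ae_all_iff]; intro q
    exact ae_condExpKernel_apply_eq_indicator hm (hA i q)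
  filter_upwards [hae] with ω hω
  -- under `κ_ω`, almost surely `h i ω' ≤ q ↔ h i ω ≤ q` for all `i`, `q`
  have hκ : ∀ (i : ℕ) (q : ℚ), ∀ᵐ ω' ∂(condExpKernel Q m ω), (h i ω' ≤ q ↔ h i ω ≤ q) := by
    intro i q
    by_cases hq : h i ω ≤ q
    · have h1 : condExpKernel Q m ω {ω' | h i ω' ≤ q} = 1 := by
        rw [hω i q, indicator_of_mem (show ω ∈ {ω' | h i ω' ≤ (q : ℝ)} from hq), Pi.one_apply]
      have h2 : condExpKernel Q m ω {ω' | h i ω' ≤ q}ᶜ = 0 := by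
        rw [measure_compl (hm _ (hA i q)) (measure_ne_top _ _), h1, measure_univ, tsub_self]
      have hev : ∀ᵐ ω' ∂(condExpKernel Q m ω), h i ω' ≤ q := ae_iff.2 h2
      filter_upwards [hev] with ω' hω'
      exact ⟨fun _ => hq, fun _ => hω'⟩
    · have h1 : condExpKernel Q m ω {ω' | h i ω' ≤ q} = 0 := by
        rw [hω i q, indicator_of_notMem (show ω ∉ {ω' | h i ω' ≤ (q : ℝ)} from hq)]
      filter_upwards [measure_eq_zero_iff_ae_notMem.1 h1] with ω' hω'
      exact ⟨fun h' => absurd h' hω', fun h' => absurd h' hq⟩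
  have hall : ∀ᵐ ω' ∂(condExpKernel Q m ω), ∀ i, h i ω' = h i ω := by
    have h' : ∀ᵐ ω' ∂(condExpKernel Q m ω), ∀ (i : ℕ) (q : ℚ), (h i ω' ≤ q ↔ h i ω ≤ q) := by
      rw [ae_all_iff]; intro i
      rw [ae_all_iff]; intro q
      exact hκ i q
    exact h'.mono fun ω' hω' i => eq_of_forall_rat_le_iff (hω' i)
  have hmeas : MeasurableSet {ω' | ∀ i, h i ω' = h i ω} := by
    rw [Set.setOf_forall]
    exact MeasurableSet.iInter fun i => measurableSet_eq_fun ((hh i).mono hm le_rfl) measurable_const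
  have hc : condExpKernel Q m ω {ω' | ∀ i, h i ω' = h i ω}ᶜ = 0 := ae_iff.1 hall
  exact (prob_compl_eq_zero_iff hmeas).1 hc

end Generic

end Summit.AtomisticToContinuum.Crystallization.Theorems.FrustratedLawDichotomyErgodicReduction

end
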